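import Summits.AtomisticToContinuum.Crystallization.Theorems.FreeSplittingCertificatesStrictSplittingRuleP1Hat

/-!
# `StrictSplittingRule` (stmt-AtomisticToContinuum-12560): the reference CELLS of the hcp tet–oct honeycomb in chart coordinates (P1 interpolant object, part 3)

Route `FreeSplittingCertificates`, crux r3 `StrictSplittingRule` (H12⋆ = `stub_coreJointCoercive`), unit b2b-freesplit-B gen 20.
VALUE = third brick of item (2) of HOME FAR-LEMMA-SPEC §15 (d) (the P1 INTERPOLANT OBJECT).  NOT a proof of H12⋆, NOT summit progress.

In chart coordinates `p = (t, x, y)` (layer, `i`, `j` offsets; chart `p1Chart`) the unit cube of an EVEN slab is decomposed into the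
corner tetrahedron at `(0,0,0)` (the tree's up-tetrahedron, edge labels `hcpTetIdx`), the corner tetrahedron at `(1,1,1)` and the four
quarter-tetrahedra of the middle octahedron around the diagonal `(0,0,1)–(1,1,0)` (= `B₁X₂` of `hcpOctUp_receipts`, cube origin at its
site `(0,0,−1)`; pieces `2,3,4,5` here = its `G₁,G₂,G₃,G₄`); the cube of an ODD slab carries the `t ↦ 1 − t` reflected decomposition
(= `hcpOctDown_receipts`).  The reference cell `p1RefCell e π` (`e = true`: even slab) is `{p | its four barycentric coordinates
p1Bary e π m p ≥ 0}` (integer coefficient table `p1BaryCoef`, vertex offsets `p1VertOff e π m ∈ {0,1}³`, the complementary corners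
`p1NonVertOff`, layer parities `p1VertPar` / `p1NonVertPar`).  Proved here: the pieces cover the cube (`exists_p1RefCell`) and lie in it,
every corner is a vertex or a listed non-vertex, Kronecker property of the barycentric tables at the vertices (by `decide` on the integer
tables), affine structure `p1Bary (p + q) = p1Bary p + p1BaryCLM q`, closedness.  The conformity of the decomposition (hat function =
barycentric coordinate on each piece) is part 4.  [folklore: P1 finite elements]
-/

noncomputable section

open Set

namespace Summit.AtomisticToContinuum.Crystallization.Theorems.StrictSplittingRuleBirth

/-! ## The reference cells: tables -/

/-- Integer coefficients `(c, c_t, c_x, c_y)` of the barycentric coordinate `c + c_t t + c_x x + c_y y` of vertex `m` of piece `π` of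
the even (`true`) / odd (`false`) reference cube.  Pieces (even cube): `0` = corner tetrahedron at `(0,0,0)` (up-tetrahedron), `1` = corner
tetrahedron at `(1,1,1)`, `2,3,4,5` = the quarters `G₁,G₂,G₃,G₄` of the octahedron around the diagonal `(0,0,1)–(1,1,0)`; odd cube: their
`t ↦ 1 − t` reflections. -/
def p1BaryCoef : Bool → Fin 6 → Fin 4 → ℤ × ℤ × ℤ × ℤ
  | true, 0, 0 => (1, -1, -1, -1) | true, 0, 1 => (0, 1, 0, 0) | true, 0, 2 => (0, 0, 1, 0) | true, 0, 3 => (0, 0, 0, 1)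
  | true, 1, 0 => (-2, 1, 1, 1) | true, 1, 1 => (1, -1, 0, 0) | true, 1, 2 => (1, 0, -1, 0) | true, 1, 3 => (1, 0, 0, -1)
  | true, 2, 0 => (1, 0, -1, 0) | true, 2, 1 => (0, 1, 0, 0) | true, 2, 2 => (-1, 0, 1, 1) | true, 2, 3 => (1, -1, 0, -1)
  | true, 3, 0 => (0, 0, 0, 1) | true, 3, 1 => (-1, 1, 1, 1) | true, 3, 2 => (1, -1, 0, -1) | true, 3, 3 => (1, 0, -1, -1)
  | true, 4, 0 => (1, -1, 0, 0) | true, 4, 1 => (0, 0, 1, 0) | true, 4, 2 => (1, 0, -1, -1) | true, 4, 3 => (-1, 1, 0, 1)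
  | true, 5, 0 => (2, -1, -1, -1) | true, 5, 1 => (1, 0, 0, -1) | true, 5, 2 => (-1, 1, 0, 1) | true, 5, 3 => (-1, 0, 1, 1)
  | false, 0, 0 => (0, 1, -1, -1) | false, 0, 1 => (1, -1, 0, 0) | false, 0, 2 => (0, 0, 1, 0) | false, 0, 3 => (0, 0, 0, 1)
  | false, 1, 0 => (-1, -1, 1, 1) | false, 1, 1 => (0, 1, 0, 0) | false, 1, 2 => (1, 0, -1, 0) | false, 1, 3 => (1, 0, 0, -1)
  | false, 2, 0 => (1, 0, -1, 0) | false, 2, 1 => (1, -1, 0, 0) | false, 2, 2 => (-1, 0, 1, 1) | false, 2, 3 => (0, 1, 0, -1)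
  | false, 3, 0 => (0, 0, 0, 1) | false, 3, 1 => (0, -1, 1, 1) | false, 3, 2 => (0, 1, 0, -1) | false, 3, 3 => (1, 0, -1, -1)
  | false, 4, 0 => (0, 1, 0, 0) | false, 4, 1 => (0, 0, 1, 0) | false, 4, 2 => (1, 0, -1, -1) | false, 4, 3 => (0, -1, 0, 1)
  | false, 5, 0 => (1, 1, -1, -1) | false, 5, 1 => (1, 0, 0, -1) | false, 5, 2 => (0, -1, 0, 1) | false, 5, 3 => (-1, 0, 1, 1)

/-- Vertex offsets `∈ {0,1}³` (order `(k, i, j)` = `(t, x, y)`) of vertex `m` of piece `π`.  Even cube: piece `0` = `{0, (1,0,0), (0,1,0),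
(0,0,1)}`, piece `1` = `{(1,1,1), (0,1,1), (1,0,1), (1,1,0)}`, pieces `2–5` = `{B₁, X₂, B₂, B₃}`, `{B₁, X₂, B₃, X₁}`, `{B₁, X₂, X₁, X₃}`,
`{B₁, X₂, X₃, B₂}` with `B₁ = (0,0,1)`, `X₂ = (1,1,0)`, `B₂ = (0,1,1)`, `B₃ = (0,1,0)`, `X₁ = (1,0,0)`, `X₃ = (1,0,1)` — exactly the quarters of
`hcpOctUp_receipts` (whose site labels are these offsets added to the cube origin `(0,0,−1)`); odd cube: the `t ↦ 1 − t` reflections. -/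
def p1VertOff : Bool → Fin 6 → Fin 4 → ℤ × ℤ × ℤ
  | true, 0, 0 => (0, 0, 0) | true, 0, 1 => (1, 0, 0) | true, 0, 2 => (0, 1, 0) | true, 0, 3 => (0, 0, 1)
  | true, 1, 0 => (1, 1, 1) | true, 1, 1 => (0, 1, 1) | true, 1, 2 => (1, 0, 1) | true, 1, 3 => (1, 1, 0)
  | true, 2, 0 => (0, 0, 1) | true, 2, 1 => (1, 1, 0) | true, 2, 2 => (0, 1, 1) | true, 2, 3 => (0, 1, 0)
  | true, 3, 0 => (0, 0, 1) | true, 3, 1 => (1, 1, 0) | true, 3, 2 => (0, 1, 0) | true, 3, 3 => (1, 0, 0)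
  | true, 4, 0 => (0, 0, 1) | true, 4, 1 => (1, 1, 0) | true, 4, 2 => (1, 0, 0) | true, 4, 3 => (1, 0, 1)
  | true, 5, 0 => (0, 0, 1) | true, 5, 1 => (1, 1, 0) | true, 5, 2 => (1, 0, 1) | true, 5, 3 => (0, 1, 1)
  | false, 0, 0 => (1, 0, 0) | false, 0, 1 => (0, 0, 0) | false, 0, 2 => (1, 1, 0) | false, 0, 3 => (1, 0, 1)
  | false, 1, 0 => (0, 1, 1) | false, 1, 1 => (1, 1, 1) | false, 1, 2 => (0, 0, 1) | false, 1, 3 => (0, 1, 0)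
  | false, 2, 0 => (1, 0, 1) | false, 2, 1 => (0, 1, 0) | false, 2, 2 => (1, 1, 1) | false, 2, 3 => (1, 1, 0)
  | false, 3, 0 => (1, 0, 1) | false, 3, 1 => (0, 1, 0) | false, 3, 2 => (1, 1, 0) | false, 3, 3 => (0, 0, 0)
  | false, 4, 0 => (1, 0, 1) | false, 4, 1 => (0, 1, 0) | false, 4, 2 => (0, 0, 0) | false, 4, 3 => (0, 0, 1)
  | false, 5, 0 => (1, 0, 1) | false, 5, 1 => (0, 1, 0) | false, 5, 2 => (0, 0, 1) | false, 5, 3 => (1, 1, 1)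

/-- The four cube corners that are NOT vertices of piece `π` (odd cube: the reflections of the even cube's list, in the same order). -/
def p1NonVertOff : Bool → Fin 6 → Fin 4 → ℤ × ℤ × ℤ
  | true, 0, 0 => (0, 1, 1) | true, 0, 1 => (1, 0, 1) | true, 0, 2 => (1, 1, 0) | true, 0, 3 => (1, 1, 1)
  | true, 1, 0 => (0, 0, 0) | true, 1, 1 => (0, 0, 1) | true, 1, 2 => (0, 1, 0) | true, 1, 3 => (1, 0, 0)
  | true, 2, 0 => (0, 0, 0) | true, 2, 1 => (1, 0, 0) | true, 2, 2 => (1, 0, 1) | true, 2, 3 => (1, 1, 1)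
  | true, 3, 0 => (0, 0, 0) | true, 3, 1 => (0, 1, 1) | true, 3, 2 => (1, 0, 1) | true, 3, 3 => (1, 1, 1)
  | true, 4, 0 => (0, 0, 0) | true, 4, 1 => (0, 1, 0) | true, 4, 2 => (0, 1, 1) | true, 4, 3 => (1, 1, 1)
  | true, 5, 0 => (0, 0, 0) | true, 5, 1 => (0, 1, 0) | true, 5, 2 => (1, 0, 0) | true, 5, 3 => (1, 1, 1)
  | false, 0, 0 => (1, 1, 1) | false, 0, 1 => (0, 0, 1) | false, 0, 2 => (0, 1, 0) | false, 0, 3 => (0, 1, 1)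
  | false, 1, 0 => (1, 0, 0) | false, 1, 1 => (1, 0, 1) | false, 1, 2 => (1, 1, 0) | false, 1, 3 => (0, 0, 0)
  | false, 2, 0 => (1, 0, 0) | false, 2, 1 => (0, 0, 0) | false, 2, 2 => (0, 0, 1) | false, 2, 3 => (0, 1, 1)
  | false, 3, 0 => (1, 0, 0) | false, 3, 1 => (1, 1, 1) | false, 3, 2 => (0, 0, 1) | false, 3, 3 => (0, 1, 1)
  | false, 4, 0 => (1, 0, 0) | false, 4, 1 => (1, 1, 0) | false, 4, 2 => (1, 1, 1) | false, 4, 3 => (0, 1, 1)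
  | false, 5, 0 => (1, 0, 0) | false, 5, 1 => (1, 1, 0) | false, 5, 2 => (0, 0, 0) | false, 5, 3 => (0, 1, 1)

/-- Layer parity (`true` = even layer) of vertex `m` of piece `π`: in the even cube a corner `c` is an even-layer site iff `c.1 = 0`, in
the odd cube iff `c.1 = 1`; by the reflection symmetry the table is the same for both cubes (`p1VertPar_eq`). -/
def p1VertPar : Fin 6 → Fin 4 → Bool
  | 0, 0 => true | 0, 1 => false | 0, 2 => true | 0, 3 => true
  | 1, 0 => false | 1, 1 => true | 1, 2 => false | 1, 3 => false
  | 2, 0 => true | 2, 1 => false | 2, 2 => true | 2, 3 => true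
  | 3, 0 => true | 3, 1 => false | 3, 2 => true | 3, 3 => false
  | 4, 0 => true | 4, 1 => false | 4, 2 => false | 4, 3 => false
  | 5, 0 => true | 5, 1 => false | 5, 2 => false | 5, 3 => true

/-- Layer parity (`true` = even layer) of the listed non-vertex `m` of piece `π` (same for both cubes, `p1NonVertPar_eq`). -/
def p1NonVertPar : Fin 6 → Fin 4 → Bool
  | 0, 0 => true | 0, 1 => false | 0, 2 => false | 0, 3 => false
  | 1, 0 => true | 1, 1 => true | 1, 2 => true | 1, 3 => false
  | 2, 0 => true | 2, 1 => false | 2, 2 => false | 2, 3 => false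
  | 3, 0 => true | 3, 1 => true | 3, 2 => false | 3, 3 => false
  | 4, 0 => true | 4, 1 => true | 4, 2 => true | 4, 3 => false
  | 5, 0 => true | 5, 1 => true | 5, 2 => false | 5, 3 => false

/-- Layer parity of the site at corner `c ∈ {0,1}³` of the even (`e = true`) / odd cube: even iff `c.1 = 0` / `c.1 = 1`. -/
def p1CornerEven (e : Bool) (c : ℤ × ℤ × ℤ) : Bool :=
  match e with
  | true => decide (c.1 = 0)
  | false => decide (c.1 = 1)

/-- The vertex parity table is the corner parity of the vertex offsets. -/
theorem p1VertPar_eq (e : Bool) (π : Fin 6) (m : Fin 4) : p1VertPar π m = p1CornerEven e (p1VertOff e π m) := by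
  fin_cases e <;> fin_cases π <;> fin_cases m <;> rfl

/-- The non-vertex parity table is the corner parity of the non-vertex offsets. -/
theorem p1NonVertPar_eq (e : Bool) (π : Fin 6) (m : Fin 4) : p1NonVertPar π m = p1CornerEven e (p1NonVertOff e π m) := by
  fin_cases e <;> fin_cases π <;> fin_cases m <;> rfl

/-- The barycentric coordinate of vertex `m` of piece `π` (an affine function of the local coordinates `p = (t, x, y)`). -/
def p1Bary (e : Bool) (π : Fin 6) (m : Fin 4) (p : Fin 3 → ℝ) : ℝ :=
  ((p1BaryCoef e π m).1 : ℝ) + ((p1BaryCoef e π m).2.1 : ℝ) * p 0 + ((p1BaryCoef e π m).2.2.1 : ℝ) * p 1 +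
    ((p1BaryCoef e π m).2.2.2 : ℝ) * p 2

/-- **The reference cell**: piece `π` of the even/odd unit cube = `{p | all four barycentric coordinates ≥ 0}` (a closed tetrahedron). -/
def p1RefCell (e : Bool) (π : Fin 6) : Set (Fin 3 → ℝ) := {p | ∀ m, 0 ≤ p1Bary e π m p}

/-! ## Cover, containment, Kronecker property, affine structure -/

/-- The reference cells lie in the unit cube. -/
theorem p1RefCell_subset_cube {e : Bool} {π : Fin 6} {p : Fin 3 → ℝ} (hp : p ∈ p1RefCell e π) (i : Fin 3) :
    0 ≤ p i ∧ p i ≤ 1 := by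
  have h0 := hp 0; have h1 := hp 1; have h2 := hp 2; have h3 := hp 3
  fin_cases e <;> fin_cases π <;> fin_cases i <;>
    simp only [p1Bary, p1BaryCoef, Int.cast_zero, Int.cast_one, Int.cast_neg, Int.cast_ofNat, Fin.zero_eta, Fin.mk_one,
      Fin.reduceFinMk] at h0 h1 h2 h3 ⊢ <;> norm_num at h0 h1 h2 h3 ⊢ <;>
    constructor <;> linarith

/-- **Cover (even cube)**: every point of the unit cube lies in one of the six even pieces. -/
theorem exists_p1RefCell_true {p : Fin 3 → ℝ} (hp : ∀ i, 0 ≤ p i ∧ p i ≤ 1) : ∃ π, p ∈ p1RefCell true π := by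
  have ht := hp 0; have hx := hp 1; have hy := hp 2
  by_cases hlo : p 0 + p 1 + p 2 ≤ 1
  · refine ⟨0, fun m => ?_⟩
    fin_cases m <;> simp only [p1Bary, p1BaryCoef] <;> norm_num <;> linarith
  by_cases hhi : 2 ≤ p 0 + p 1 + p 2
  · refine ⟨1, fun m => ?_⟩
    fin_cases m <;> simp only [p1Bary, p1BaryCoef] <;> norm_num <;> linarith
  by_cases hxy : 1 ≤ p 1 + p 2
  · by_cases hyt : p 2 + p 0 ≤ 1
    · refine ⟨2, fun m => ?_⟩
      fin_cases m <;> simp only [p1Bary, p1BaryCoef] <;> norm_num <;> linarith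
    · refine ⟨5, fun m => ?_⟩
      fin_cases m <;> simp only [p1Bary, p1BaryCoef] <;> norm_num <;> linarith
  · by_cases hyt : p 2 + p 0 ≤ 1
    · refine ⟨3, fun m => ?_⟩
      fin_cases m <;> simp only [p1Bary, p1BaryCoef] <;> norm_num <;> linarith
    · refine ⟨4, fun m => ?_⟩
      fin_cases m <;> simp only [p1Bary, p1BaryCoef] <;> norm_num <;> linarith

/-- **Cover (odd cube)**: every point of the unit cube lies in one of the six odd pieces. -/
theorem exists_p1RefCell_false {p : Fin 3 → ℝ} (hp : ∀ i, 0 ≤ p i ∧ p i ≤ 1) : ∃ π, p ∈ p1RefCell false π := by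
  have ht := hp 0; have hx := hp 1; have hy := hp 2
  by_cases hlo : p 1 + p 2 ≤ p 0
  · refine ⟨0, fun m => ?_⟩
    fin_cases m <;> simp only [p1Bary, p1BaryCoef] <;> norm_num <;> linarith
  by_cases hhi : 1 + p 0 ≤ p 1 + p 2
  · refine ⟨1, fun m => ?_⟩
    fin_cases m <;> simp only [p1Bary, p1BaryCoef] <;> norm_num <;> linarith
  by_cases hxy : 1 ≤ p 1 + p 2
  · by_cases hyt : p 2 ≤ p 0
    · refine ⟨2, fun m => ?_⟩
      fin_cases m <;> simp only [p1Bary, p1BaryCoef] <;> norm_num <;> linarith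
    · refine ⟨5, fun m => ?_⟩
      fin_cases m <;> simp only [p1Bary, p1BaryCoef] <;> norm_num <;> linarith
  · by_cases hyt : p 2 ≤ p 0
    · refine ⟨3, fun m => ?_⟩
      fin_cases m <;> simp only [p1Bary, p1BaryCoef] <;> norm_num <;> linarith
    · refine ⟨4, fun m => ?_⟩
      fin_cases m <;> simp only [p1Bary, p1BaryCoef] <;> norm_num <;> linarith

/-- **Cover**: every point of the unit cube lies in one of the six pieces, for either parity. -/
theorem exists_p1RefCell (e : Bool) {p : Fin 3 → ℝ} (hp : ∀ i, 0 ≤ p i ∧ p i ≤ 1) : ∃ π, p ∈ p1RefCell e π := by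
  cases e
  · exact exists_p1RefCell_false hp
  · exact exists_p1RefCell_true hp

/-- Every cube corner is a vertex or a listed non-vertex of each piece (decidable table check). -/
theorem p1Corner_cases_tab : ∀ (e : Bool) (π : Fin 6) (c0 c1 c2 : Fin 2),
    (∃ m, (((c0 : ℕ) : ℤ), ((c1 : ℕ) : ℤ), ((c2 : ℕ) : ℤ)) = p1VertOff e π m) ∨
      ∃ m, (((c0 : ℕ) : ℤ), ((c1 : ℕ) : ℤ), ((c2 : ℕ) : ℤ)) = p1NonVertOff e π m := by
  decide

/-- Every cube corner is a vertex or a listed non-vertex of each piece. -/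
theorem p1Corner_cases (e : Bool) (π : Fin 6) (c : ℤ × ℤ × ℤ) (h0 : c.1 = 0 ∨ c.1 = 1) (h1 : c.2.1 = 0 ∨ c.2.1 = 1)
    (h2 : c.2.2 = 0 ∨ c.2.2 = 1) : (∃ m, c = p1VertOff e π m) ∨ ∃ m, c = p1NonVertOff e π m := by
  obtain ⟨a, b, d⟩ := c
  simp only at h0 h1 h2
  rcases h0 with rfl | rfl <;> rcases h1 with rfl | rfl <;> rcases h2 with rfl | rfl
  · exact p1Corner_cases_tab e π 0 0 0
  · exact p1Corner_cases_tab e π 0 0 1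
  · exact p1Corner_cases_tab e π 0 1 0
  · exact p1Corner_cases_tab e π 0 1 1
  · exact p1Corner_cases_tab e π 1 0 0
  · exact p1Corner_cases_tab e π 1 0 1
  · exact p1Corner_cases_tab e π 1 1 0
  · exact p1Corner_cases_tab e π 1 1 1

/-- The vertex offsets of a piece are pairwise distinct (decidable table check). -/
theorem p1VertOff_injective (e : Bool) (π : Fin 6) : Function.Injective (p1VertOff e π) := by
  intro m m' h
  revert e π m m'
  decide

/-- The vertex offsets have entries in `{0, 1}` (decidable table check). -/
theorem p1VertOff_mem (e : Bool) (π : Fin 6) (m : Fin 4) :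
    ((p1VertOff e π m).1 = 0 ∨ (p1VertOff e π m).1 = 1) ∧ ((p1VertOff e π m).2.1 = 0 ∨ (p1VertOff e π m).2.1 = 1) ∧
      ((p1VertOff e π m).2.2 = 0 ∨ (p1VertOff e π m).2.2 = 1) := by
  revert e π m
  decide

/-- Integer form of the barycentric coordinate at an integer point. -/
def p1BaryInt (e : Bool) (π : Fin 6) (m : Fin 4) (c : ℤ × ℤ × ℤ) : ℤ :=
  (p1BaryCoef e π m).1 + (p1BaryCoef e π m).2.1 * c.1 + (p1BaryCoef e π m).2.2.1 * c.2.1 + (p1BaryCoef e π m).2.2.2 * c.2.2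

/-- The real barycentric coordinate at an integer point is the cast of the integer form. -/
theorem p1Bary_p1Vec (e : Bool) (π : Fin 6) (m : Fin 4) (c : ℤ × ℤ × ℤ) :
    p1Bary e π m (p1Vec c) = (p1BaryInt e π m c : ℝ) := by
  simp [p1Bary, p1BaryInt]

/-- Kronecker property, integer form (decidable table check). -/
theorem p1BaryInt_vert : ∀ (e : Bool) (π : Fin 6) (m m' : Fin 4),
    p1BaryInt e π m (p1VertOff e π m') = if m = m' then 1 else 0 := by
  decide

/-- **Kronecker property**: the barycentric coordinate of vertex `m` is `1` at vertex `m` and `0` at the other vertices. -/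
theorem p1Bary_vert (e : Bool) (π : Fin 6) (m m' : Fin 4) :
    p1Bary e π m (p1Vec (p1VertOff e π m')) = if m = m' then 1 else 0 := by
  rw [p1Bary_p1Vec, p1BaryInt_vert]
  split_ifs <;> simp

/-- The vertices of a piece belong to it. -/
theorem p1Vec_vertOff_mem (e : Bool) (π : Fin 6) (m : Fin 4) : p1Vec (p1VertOff e π m) ∈ p1RefCell e π := by
  intro m'
  rw [p1Bary_vert]
  split_ifs <;> norm_num

/-- The linear part of the barycentric coordinate, as a continuous linear functional. -/
def p1BaryCLM (e : Bool) (π : Fin 6) (m : Fin 4) : (Fin 3 → ℝ) →L[ℝ] ℝ :=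
  ((p1BaryCoef e π m).2.1 : ℝ) • ContinuousLinearMap.proj 0 + ((p1BaryCoef e π m).2.2.1 : ℝ) • ContinuousLinearMap.proj 1 +
    ((p1BaryCoef e π m).2.2.2 : ℝ) • ContinuousLinearMap.proj 2

/-- The continuous linear functional acts as the linear part of the barycentric coordinate. -/
@[simp] theorem p1BaryCLM_apply (e : Bool) (π : Fin 6) (m : Fin 4) (p : Fin 3 → ℝ) :
    p1BaryCLM e π m p = ((p1BaryCoef e π m).2.1 : ℝ) * p 0 + ((p1BaryCoef e π m).2.2.1 : ℝ) * p 1 +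
      ((p1BaryCoef e π m).2.2.2 : ℝ) * p 2 := by
  simp [p1BaryCLM]

/-- The barycentric coordinate is affine: `λ(p + q) = λ p + (linear part) q`. -/
theorem p1Bary_add (e : Bool) (π : Fin 6) (m : Fin 4) (p q : Fin 3 → ℝ) :
    p1Bary e π m (p + q) = p1Bary e π m p + p1BaryCLM e π m q := by
  simp only [p1Bary, p1BaryCLM_apply, Pi.add_apply]
  ring

/-- The barycentric coordinate is affine: `λ(p − q) = λ p − (linear part) q`. -/
theorem p1Bary_sub (e : Bool) (π : Fin 6) (m : Fin 4) (p q : Fin 3 → ℝ) :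
    p1Bary e π m (p - q) = p1Bary e π m p - p1BaryCLM e π m q := by
  simp only [p1Bary, p1BaryCLM_apply, Pi.sub_apply]
  ring

/-- Continuity of the barycentric coordinates. -/
theorem continuous_p1Bary (e : Bool) (π : Fin 6) (m : Fin 4) : Continuous (p1Bary e π m) := by
  unfold p1Bary
  fun_prop

/-- The reference cells are closed. -/
theorem isClosed_p1RefCell (e : Bool) (π : Fin 6) : IsClosed (p1RefCell e π) := by
  have : p1RefCell e π = ⋂ m, {p | 0 ≤ p1Bary e π m p} := by
    ext p; simp [p1RefCell]
  rw [this]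
  exact isClosed_iInter fun m => isClosed_le continuous_const (continuous_p1Bary e π m)

end Summit.AtomisticToContinuum.Crystallization.Theorems.StrictSplittingRuleBirth
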